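import Summits.BirchSwinnertonDyer.BirchSwinnertonDyer.Theorems.Rank2ObservatoryReductionWitness2
import HarnessLib

/-!
# BirchSwinnertonDyer — rank ≥ 2 observatory: kernel rank certificates for NON-INTEGRAL points

HONEST FRAMING: per-curve certified theorems and census instruments; no claim on BSD in rank ≥ 2.

`Rank2ObservatoryReductionWitness.lean` / `…Witness2.lean` certify `2 ≤ rank_ℤ E(ℚ)` from three
INTEGRAL points. About a quarter of the rank-2 census rows have a listed generator, or the sum
`P₁ ± P₂`, with a denominator. This file removes that restriction: a rational point `(x, y)` whose
denominators are prime to `q` reduces under `reduceMod V q` (the tree's `goodReductionHom` over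
`ℤ_q`) to the affine point `(m, m′) mod q` for any integers `m, m′` with `q ∣ x.num − m·x.den`,
`q ∣ y.num − m′·y.den` (`reduceMod_some_rat`: the `ℤ_q`-representative `⟨x, ‖x‖_q ≤ 1⟩` and
`PadicInt.residueField`). With the exact rational chord certificate `ratChord` (Mathlib's
`add_of_X_ne`) this gives the assemblies `two_le_mordellWeilRank_of_ratCert` (odd torsion
annihilator, doubling witnesses `xDoubleFree`) and `two_le_mordellWeilRank_of_ratCert₂`
(annihilator `≡ 2 mod 4`, coset witnesses `xCosetFree`) — every hypothesis a decidable statement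
about the row's rationals / integers / residues, discharged per curve by `decide` (kernel).
Sorry-free; axioms `propext`, `Classical.choice`, `Quot.sound` only.
References: Silverman AEC (2009) III.2.3, VII.2, Prop. VII.3.1(b), Thm. VIII.6.7; Cremona (1997) §3.5.
-/

-- single-conjunct summit: `Summit.BirchSwinnertonDyer.BirchSwinnertonDyer.…` repeats the name by design
set_option linter.dupNamespace false

namespace Summit.BirchSwinnertonDyer.BirchSwinnertonDyer.Rank2Observatory

open WeierstrassCurve Literature.NumberTheory.EllipticCurves

section Reduction

variable (V : WeierstrassCurve ℤ) (q : ℕ) [Fact q.Prime]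

/-- Two affine points with equal coordinates are equal. [folklore] -/
private theorem point_some_congr₃ {F : Type*} [CommRing F] {W : Affine F} {x y x' y' : F}
    (hx : x = x') (hy : y = y') {h : W.Nonsingular x y} {h' : W.Nonsingular x' y'} :
    Affine.Point.some x y h = .some x' y' h' := by
  subst hx hy
  rfl

/-- Transport of `Point.some` along equal coordinates. [folklore] -/
private theorem some_congr₃ {F : Type*} [CommRing F] {W : Affine F} {x y x' y' : F}
    (hx : x = x') (hy : y = y') (h : W.Nonsingular x y) :
    ∃ h' : W.Nonsingular x' y', Affine.Point.some x y h = .some x' y' h' := by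
  subst hx hy
  exact ⟨h, rfl⟩

/-- A rational number with denominator prime to `q`, as an element of `ℤ_q` (`‖x‖_q ≤ 1`).
[folklore] -/
noncomputable def ratPadicInt (x : ℚ) (hx : ¬ q ∣ x.den) : ℤ_[q] :=
  ⟨(x : ℚ_[q]), Padic.norm_rat_le_one hx⟩

/-- `ratPadicInt q x · den(x) = num(x)` in `ℤ_q`. [folklore] -/
theorem ratPadicInt_mul_den (x : ℚ) (hx : ¬ q ∣ x.den) :
    ratPadicInt q x hx * (x.den : ℤ_[q]) = (x.num : ℤ_[q]) := by
  apply Subtype.ext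
  rw [PadicInt.coe_mul, PadicInt.coe_natCast, PadicInt.coe_intCast]
  show (x : ℚ_[q]) * (x.den : ℚ_[q]) = (x.num : ℚ_[q])
  have h := congrArg (fun r : ℚ => (r : ℚ_[q])) (Rat.mul_den_eq_num x)
  push_cast at h
  exact h

/-- The residue of `ratPadicInt q x` in `ZMod q` is `m` whenever `q ∣ num(x) − m·den(x)`
(i.e. `m ≡ x mod q`). [folklore] -/
theorem residue_ratPadicInt (x : ℚ) (hx : ¬ q ∣ x.den) {m : ℤ}
    (hm : (q : ℤ) ∣ x.num - m * x.den) :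
    ((PadicInt.residueField (p := q) : IsLocalRing.ResidueField ℤ_[q] →+* ZMod q).comp
        (IsLocalRing.residue ℤ_[q])) (ratPadicInt q x hx) = (m : ZMod q) := by
  set ψ : ℤ_[q] →+* ZMod q :=
    (PadicInt.residueField (p := q) : IsLocalRing.ResidueField ℤ_[q] →+* ZMod q).comp
      (IsLocalRing.residue ℤ_[q])
  have hden : (x.den : ZMod q) ≠ 0 := fun h => hx ((ZMod.natCast_eq_zero_iff _ _).1 h)
  have h1 : ψ (ratPadicInt q x hx) * (x.den : ZMod q) = (x.num : ZMod q) := by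
    have h := congrArg ψ (ratPadicInt_mul_den q x hx)
    rwa [map_mul, map_natCast, map_intCast] at h
  have h2 : (x.num : ZMod q) = (m : ZMod q) * (x.den : ZMod q) := by
    have h0 : ((x.num - m * x.den : ℤ) : ZMod q) = 0 :=
      (ZMod.intCast_zmod_eq_zero_iff_dvd _ _).mpr hm
    push_cast at h0
    exact sub_eq_zero.mp h0
  exact mul_right_cancel₀ hden (h1.trans h2)

open scoped Classical in
/-- **The reduction map on a `q`-integral rational point of `V`**: if `q ∤ Δ(V)`, `(x, y) ∈ E(ℚ)`
has denominators prime to `q`, and `m ≡ x`, `m′ ≡ y (mod q)`, then `reduceMod V q (x, y) = (m, m′)`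
(the tree's `reducePoint_some_algebraMap` for the `ℤ_q`-representative `⟨x, ‖x‖_q ≤ 1⟩`).
[cite: SilvermanAEC2009, VII.2] -/
theorem reduceMod_some_rat (hq : ¬ (q : ℤ) ∣ V.Δ) {x y : ℚ}
    (h : (V.map (Int.castRingHom ℚ)).toAffine.Nonsingular x y) (hx : ¬ q ∣ x.den)
    (hy : ¬ q ∣ y.den) {m m' : ℤ} (hm : (q : ℤ) ∣ x.num - m * x.den)
    (hm' : (q : ℤ) ∣ y.num - m' * y.den) :
    ∃ h' : (V.map (Int.castRingHom (ZMod q))).toAffine.Nonsingular (m : ZMod q) (m' : ZMod q),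
      reduceMod V q hq (.some x y h) = .some (m : ZMod q) (m' : ZMod q) h' := by
  letI := ((PadicInt.residueField (p := q)).toRingHom).toAlgebra
  have hxe : Algebra.ofId ℚ ℚ_[q] x = algebraMap ℤ_[q] ℚ_[q] (ratPadicInt q x hx) := by
    rw [Algebra.ofId_apply]; exact (map_ratCast (algebraMap ℚ ℚ_[q]) x).trans rfl
  have hye : Algebra.ofId ℚ ℚ_[q] y = algebraMap ℤ_[q] ℚ_[q] (ratPadicInt q y hy) := by
    rw [Algebra.ofId_apply]; exact (map_ratCast (algebraMap ℚ ℚ_[q]) y).trans rfl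
  simp only [reduceMod, residuePointHom, AddMonoidHom.coe_comp, Function.comp_apply,
    AddEquiv.coe_toAddMonoidHom]
  rw [Affine.Point.congrEquiv_some, Affine.Point.map_some, Affine.Point.congrEquiv_some]
  obtain ⟨hP, e⟩ := some_congr₃
    (W := ((V.map (Int.castRingHom ℤ_[q])).baseChange ℚ_[q]).toAffine) hxe hye _
  have eZ : (V.map (Int.castRingHom ℤ_[q])).toAffine.Equation (ratPadicInt q x hx)
      (ratPadicInt q y hy) :=
    (Affine.map_equation _ (padicInt_valuationIntegers q).hom_inj _ _).mp hP.left
  have hns : ((V.map (Int.castRingHom ℤ_[q])).map (IsLocalRing.residue ℤ_[q])).toAffine.Nonsingular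
      (IsLocalRing.residue ℤ_[q] (ratPadicInt q x hx))
      (IsLocalRing.residue ℤ_[q] (ratPadicInt q y hy)) := by
    haveI := isElliptic_map_residue (isUnit_Δ_map_padicInt V q hq)
    exact (Affine.equation_iff_nonsingular).mp (Affine.Equation.map (IsLocalRing.residue ℤ_[q]) eZ)
  rw [e, goodReductionHom_apply, WeierstrassCurve.reducePoint_some_algebraMap
    (padicInt_valuationIntegers q).hom_inj hP hns, Affine.Point.congrEquiv_some,
    Affine.Point.map_some, Affine.Point.congrEquiv_some]
  have hxm := residue_ratPadicInt q x hx hm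
  have hym := residue_ratPadicInt q y hy hm'
  have eq' : (V.map (Int.castRingHom (ZMod q))).toAffine.Equation (m : ZMod q) (m' : ZMod q) := by
    have h0 : ((V.map (Int.castRingHom ℤ_[q])).map
        ((PadicInt.residueField (p := q) : IsLocalRing.ResidueField ℤ_[q] →+* ZMod q).comp
          (IsLocalRing.residue ℤ_[q]))).toAffine.Equation
        (((PadicInt.residueField (p := q) : IsLocalRing.ResidueField ℤ_[q] →+* ZMod q).comp
          (IsLocalRing.residue ℤ_[q])) (ratPadicInt q x hx))
        (((PadicInt.residueField (p := q) : IsLocalRing.ResidueField ℤ_[q] →+* ZMod q).comp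
          (IsLocalRing.residue ℤ_[q])) (ratPadicInt q y hy)) :=
      Affine.Equation.map _ eZ
    rw [hxm, hym, WeierstrassCurve.map_map] at h0
    have hc : ((PadicInt.residueField (p := q) : IsLocalRing.ResidueField ℤ_[q] →+* ZMod q).comp
        (IsLocalRing.residue ℤ_[q])).comp (Int.castRingHom ℤ_[q]) = Int.castRingHom (ZMod q) :=
      RingHom.ext_int _ _
    rwa [hc] at h0
  exact ⟨(Affine.equation_iff_nonsingular_of_Δ_ne_zero (Δ_zmod_ne_zero V q hq)).mp eq',
    point_some_congr₃ hxm hym⟩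

end Reduction

/-! ### Rational points and the exact chord -/

section Chord

variable (V : WeierstrassCurve ℤ)

/-- A rational solution of the (integral) Weierstrass equation is a nonsingular point of `E(ℚ)`
when `Δ ≠ 0`. [folklore] -/
theorem nonsingular_rat_of_eq_rat (hΔ : V.Δ ≠ 0) {x y : ℚ}
    (hxy : y ^ 2 + (V.a₁ : ℚ) * x * y + (V.a₃ : ℚ) * y =
      x ^ 3 + (V.a₂ : ℚ) * x ^ 2 + (V.a₄ : ℚ) * x + (V.a₆ : ℚ)) :
    (V.map (Int.castRingHom ℚ)).toAffine.Nonsingular x y := by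
  have hΔ' : (V.map (Int.castRingHom ℚ)).Δ ≠ 0 := by
    rw [map_Δ, eq_intCast]; exact_mod_cast hΔ
  refine (Affine.equation_iff_nonsingular_of_Δ_ne_zero hΔ').mp ((Affine.equation_iff x y).mpr ?_)
  simpa [WeierstrassCurve.map] using hxy

/-- Exact rational CHORD CERTIFICATE (a Boolean for `decide`): `(x₃, y₃) = (x₁, y₁) + (x₂, y₂)` on
`V` with `x₁ ≠ x₂` and slope `L = (y₁ − y₂)/(x₁ − x₂)`: `x₃ = L² + a₁L − a₂ − x₁ − x₂`,
`y₃ = −(L(x₃ − x₁) + y₁) − a₁x₃ − a₃` (Silverman AEC III.2.3). [cite: SilvermanAEC2009, III.2.3] -/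
def ratChord (V : WeierstrassCurve ℤ) (x₁ y₁ x₂ y₂ x₃ y₃ : ℚ) : Bool :=
  decide (x₁ ≠ x₂ ∧
    x₃ = ((y₁ - y₂) / (x₁ - x₂)) ^ 2 + (V.a₁ : ℚ) * ((y₁ - y₂) / (x₁ - x₂)) - (V.a₂ : ℚ)
      - x₁ - x₂ ∧
    y₃ = -(((y₁ - y₂) / (x₁ - x₂)) * (x₃ - x₁) + y₁) - (V.a₁ : ℚ) * x₃ - (V.a₃ : ℚ))

/-- **Soundness of the rational chord certificate** (Mathlib's `add_of_X_ne`, `slope_of_X_ne`).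
[cite: SilvermanAEC2009, III.2.3] -/
theorem some_add_some_of_ratChord (hΔ : V.Δ ≠ 0) {x₁ y₁ x₂ y₂ x₃ y₃ : ℚ}
    (h₁ : y₁ ^ 2 + (V.a₁ : ℚ) * x₁ * y₁ + (V.a₃ : ℚ) * y₁ =
      x₁ ^ 3 + (V.a₂ : ℚ) * x₁ ^ 2 + (V.a₄ : ℚ) * x₁ + (V.a₆ : ℚ))
    (h₂ : y₂ ^ 2 + (V.a₁ : ℚ) * x₂ * y₂ + (V.a₃ : ℚ) * y₂ =
      x₂ ^ 3 + (V.a₂ : ℚ) * x₂ ^ 2 + (V.a₄ : ℚ) * x₂ + (V.a₆ : ℚ))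
    (h₃ : y₃ ^ 2 + (V.a₁ : ℚ) * x₃ * y₃ + (V.a₃ : ℚ) * y₃ =
      x₃ ^ 3 + (V.a₂ : ℚ) * x₃ ^ 2 + (V.a₄ : ℚ) * x₃ + (V.a₆ : ℚ))
    (hc : ratChord V x₁ y₁ x₂ y₂ x₃ y₃ = true) :
    (Affine.Point.some _ _ (nonsingular_rat_of_eq_rat V hΔ h₁) :
        (V.map (Int.castRingHom ℚ)).toAffine.Point) + .some _ _ (nonsingular_rat_of_eq_rat V hΔ h₂) =
      .some _ _ (nonsingular_rat_of_eq_rat V hΔ h₃) := by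
  classical
  simp only [ratChord, decide_eq_true_eq] at hc
  obtain ⟨hne, hX, hY⟩ := hc
  have ha₁ : (V.map (Int.castRingHom ℚ)).a₁ = (V.a₁ : ℚ) := by simp [WeierstrassCurve.map]
  have ha₂ : (V.map (Int.castRingHom ℚ)).a₂ = (V.a₂ : ℚ) := by simp [WeierstrassCurve.map]
  have ha₃ : (V.map (Int.castRingHom ℚ)).a₃ = (V.a₃ : ℚ) := by simp [WeierstrassCurve.map]
  rw [Affine.Point.add_of_X_ne hne, Affine.Point.some.injEq, Affine.slope_of_X_ne hne]
  refine ⟨?_, ?_⟩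
  · rw [hX]; simp only [Affine.addX, ha₁, ha₂]
  · rw [hY, hX]; simp only [Affine.addY, Affine.negAddY, Affine.negY, Affine.addX, ha₁, ha₂, ha₃]

end Chord

/-! ### The assembled rational certificates -/

section Assembly

variable (V : WeierstrassCurve ℤ)

/-- **`2 ≤ rank_ℤ E(ℚ)` from a kernel-checkable certificate with RATIONAL points, odd torsion
annihilator**: `P₁, P₂, P₃ = P₁ + P₂ ∈ E(ℚ)` (exact chord `ratChord`), an odd `t` with
`annihilatorCheck S t` over kernel-counted good primes, and good primes `qᵢ` prime to the
denominators of `Pᵢ` at which the residue `x(Pᵢ) ≡ mᵢ (mod qᵢ)` is double-free (`xDoubleFree`);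
conclusion via `two_le_mordellWeilRank_of_cosetWitness` (`u = 0`) and `reduceMod_some_rat`.
[cite: SilvermanAEC2009, Thm. VIII.6.7] [cite: CremonaAlgorithms1997, §3.5] -/
theorem two_le_mordellWeilRank_of_ratCert {x₁ y₁ x₂ y₂ x₃ y₃ : ℚ}
    (h₁ : y₁ ^ 2 + (V.a₁ : ℚ) * x₁ * y₁ + (V.a₃ : ℚ) * y₁ =
      x₁ ^ 3 + (V.a₂ : ℚ) * x₁ ^ 2 + (V.a₄ : ℚ) * x₁ + (V.a₆ : ℚ))
    (h₂ : y₂ ^ 2 + (V.a₁ : ℚ) * x₂ * y₂ + (V.a₃ : ℚ) * y₂ =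
      x₂ ^ 3 + (V.a₂ : ℚ) * x₂ ^ 2 + (V.a₄ : ℚ) * x₂ + (V.a₆ : ℚ))
    (h₃ : y₃ ^ 2 + (V.a₁ : ℚ) * x₃ * y₃ + (V.a₃ : ℚ) * y₃ =
      x₃ ^ 3 + (V.a₂ : ℚ) * x₃ ^ 2 + (V.a₄ : ℚ) * x₃ + (V.a₆ : ℚ))
    (hc : ratChord V x₁ y₁ x₂ y₂ x₃ y₃ = true) {S : List (ℕ × ℕ)} {t : ℕ} (hodd : t % 2 = 1)
    (hS : ∀ ℓN ∈ S, ℓN.1.Prime ∧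
      ∀ (x : (V.map (Int.castRingHom ℚ)).toAffine.Point) (n : ℕ), ¬ ℓN.1 ∣ n → n • x = 0 →
        ℓN.2 • x = 0)
    (ht : annihilatorCheck S t = true) (q₁ q₂ q₃ : ℕ) [Fact q₁.Prime] [Fact q₂.Prime]
    [Fact q₃.Prime] (hq₁ : ¬ (q₁ : ℤ) ∣ V.Δ) (hq₂ : ¬ (q₂ : ℤ) ∣ V.Δ) (hq₃ : ¬ (q₃ : ℤ) ∣ V.Δ)
    (hd₁ : ¬ q₁ ∣ x₁.den ∧ ¬ q₁ ∣ y₁.den) (hd₂ : ¬ q₂ ∣ x₂.den ∧ ¬ q₂ ∣ y₂.den)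
    (hd₃ : ¬ q₃ ∣ x₃.den ∧ ¬ q₃ ∣ y₃.den) (m₁ n₁ m₂ n₂ m₃ n₃ : ℤ)
    (hm₁ : (q₁ : ℤ) ∣ x₁.num - m₁ * x₁.den ∧ (q₁ : ℤ) ∣ y₁.num - n₁ * y₁.den)
    (hm₂ : (q₂ : ℤ) ∣ x₂.num - m₂ * x₂.den ∧ (q₂ : ℤ) ∣ y₂.num - n₂ * y₂.den)
    (hm₃ : (q₃ : ℤ) ∣ x₃.num - m₃ * x₃.den ∧ (q₃ : ℤ) ∣ y₃.num - n₃ * y₃.den)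
    (hw₁ : xDoubleFree V q₁ (m₁ : ZMod q₁) = true) (hw₂ : xDoubleFree V q₂ (m₂ : ZMod q₂) = true)
    (hw₃ : xDoubleFree V q₃ (m₃ : ZMod q₃) = true) :
    2 ≤ (V.map (Int.castRingHom ℚ)).mordellWeilRank := by
  classical
  have hΔ : V.Δ ≠ 0 := Δ_ne_zero_of_not_dvd V hq₁
  haveI := isElliptic_rat V hΔ
  have hm : Odd (t : ℤ) := Int.odd_iff.mpr (by omega)
  have htors : ∀ x : (V.map (Int.castRingHom ℚ)).toAffine.Point, IsOfFinAddOrder x →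
      ((2 : ℤ) ^ 0 * (t : ℤ)) • x = 0 :=
    fun x hx => zsmul_eq_zero_of_annihilatorCheck hS ht (by simp) x hx
  refine two_le_mordellWeilRank_of_cosetWitness (V.map (Int.castRingHom ℚ)) hm htors
    (P₁ := .some _ _ (nonsingular_rat_of_eq_rat V hΔ h₁))
    (P₂ := .some _ _ (nonsingular_rat_of_eq_rat V hΔ h₂))
    (reduceMod V q₁ hq₁) (reduceMod V q₂ hq₂) (reduceMod V q₃ hq₃) ?_ ?_ ?_
  · obtain ⟨h', e⟩ := reduceMod_some_rat V q₁ hq₁ (nonsingular_rat_of_eq_rat V hΔ h₁) hd₁.1 hd₁.2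
      hm₁.1 hm₁.2
    rw [e]
    exact not_mem_twoCoset_of_xDoubleFree V q₁ hw₁ _
  · obtain ⟨h', e⟩ := reduceMod_some_rat V q₂ hq₂ (nonsingular_rat_of_eq_rat V hΔ h₂) hd₂.1 hd₂.2
      hm₂.1 hm₂.2
    rw [e]
    exact not_mem_twoCoset_of_xDoubleFree V q₂ hw₂ _
  · rw [some_add_some_of_ratChord V hΔ h₁ h₂ h₃ hc]
    obtain ⟨h', e⟩ := reduceMod_some_rat V q₃ hq₃ (nonsingular_rat_of_eq_rat V hΔ h₃) hd₃.1 hd₃.2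
      hm₃.1 hm₃.2
    rw [e]
    exact not_mem_twoCoset_of_xDoubleFree V q₃ hw₃ _

/-- **`2 ≤ rank_ℤ E(ℚ)` from a kernel-checkable certificate with RATIONAL points, torsion
annihilator `t ≡ 2 (mod 4)`** (`u = 1`): as `two_le_mordellWeilRank_of_ratCert` with the coset
test `xCosetFree` (`P̃ᵢ ∉ 2Ẽ(𝔽_q) + Ẽ(𝔽_q)[2]`) at the residues `(mᵢ, nᵢ)` of `Pᵢ`.
[cite: SilvermanAEC2009, Thm. VIII.6.7] [cite: CremonaAlgorithms1997, §3.5] -/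
theorem two_le_mordellWeilRank_of_ratCert₂ {x₁ y₁ x₂ y₂ x₃ y₃ : ℚ}
    (h₁ : y₁ ^ 2 + (V.a₁ : ℚ) * x₁ * y₁ + (V.a₃ : ℚ) * y₁ =
      x₁ ^ 3 + (V.a₂ : ℚ) * x₁ ^ 2 + (V.a₄ : ℚ) * x₁ + (V.a₆ : ℚ))
    (h₂ : y₂ ^ 2 + (V.a₁ : ℚ) * x₂ * y₂ + (V.a₃ : ℚ) * y₂ =
      x₂ ^ 3 + (V.a₂ : ℚ) * x₂ ^ 2 + (V.a₄ : ℚ) * x₂ + (V.a₆ : ℚ))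
    (h₃ : y₃ ^ 2 + (V.a₁ : ℚ) * x₃ * y₃ + (V.a₃ : ℚ) * y₃ =
      x₃ ^ 3 + (V.a₂ : ℚ) * x₃ ^ 2 + (V.a₄ : ℚ) * x₃ + (V.a₆ : ℚ))
    (hc : ratChord V x₁ y₁ x₂ y₂ x₃ y₃ = true) {S : List (ℕ × ℕ)} {t : ℕ} (ht2 : t % 4 = 2)
    (hS : ∀ ℓN ∈ S, ℓN.1.Prime ∧
      ∀ (x : (V.map (Int.castRingHom ℚ)).toAffine.Point) (n : ℕ), ¬ ℓN.1 ∣ n → n • x = 0 →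
        ℓN.2 • x = 0)
    (ht : annihilatorCheck S t = true) (q₁ q₂ q₃ : ℕ) [Fact q₁.Prime] [Fact q₂.Prime]
    [Fact q₃.Prime] (hq₁ : ¬ (q₁ : ℤ) ∣ V.Δ) (hq₂ : ¬ (q₂ : ℤ) ∣ V.Δ) (hq₃ : ¬ (q₃ : ℤ) ∣ V.Δ)
    (hd₁ : ¬ q₁ ∣ x₁.den ∧ ¬ q₁ ∣ y₁.den) (hd₂ : ¬ q₂ ∣ x₂.den ∧ ¬ q₂ ∣ y₂.den)
    (hd₃ : ¬ q₃ ∣ x₃.den ∧ ¬ q₃ ∣ y₃.den) (m₁ n₁ m₂ n₂ m₃ n₃ : ℤ)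
    (hm₁ : (q₁ : ℤ) ∣ x₁.num - m₁ * x₁.den ∧ (q₁ : ℤ) ∣ y₁.num - n₁ * y₁.den)
    (hm₂ : (q₂ : ℤ) ∣ x₂.num - m₂ * x₂.den ∧ (q₂ : ℤ) ∣ y₂.num - n₂ * y₂.den)
    (hm₃ : (q₃ : ℤ) ∣ x₃.num - m₃ * x₃.den ∧ (q₃ : ℤ) ∣ y₃.num - n₃ * y₃.den)
    (hw₁ : xCosetFree V q₁ (m₁ : ZMod q₁) (n₁ : ZMod q₁) = true)
    (hw₂ : xCosetFree V q₂ (m₂ : ZMod q₂) (n₂ : ZMod q₂) = true)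
    (hw₃ : xCosetFree V q₃ (m₃ : ZMod q₃) (n₃ : ZMod q₃) = true) :
    2 ≤ (V.map (Int.castRingHom ℚ)).mordellWeilRank := by
  classical
  have hΔ : V.Δ ≠ 0 := Δ_ne_zero_of_not_dvd V hq₁
  haveI := isElliptic_rat V hΔ
  have hm : Odd ((t / 2 : ℕ) : ℤ) := Int.odd_iff.mpr (by omega)
  have htm : (t : ℤ) = 2 ^ 1 * ((t / 2 : ℕ) : ℤ) := by rw [pow_one]; omega
  have htors : ∀ x : (V.map (Int.castRingHom ℚ)).toAffine.Point, IsOfFinAddOrder x →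
      ((2 : ℤ) ^ 1 * ((t / 2 : ℕ) : ℤ)) • x = 0 :=
    fun x hx => zsmul_eq_zero_of_annihilatorCheck hS ht htm x hx
  refine two_le_mordellWeilRank_of_cosetWitness (V.map (Int.castRingHom ℚ)) hm htors
    (P₁ := .some _ _ (nonsingular_rat_of_eq_rat V hΔ h₁))
    (P₂ := .some _ _ (nonsingular_rat_of_eq_rat V hΔ h₂))
    (reduceMod V q₁ hq₁) (reduceMod V q₂ hq₂) (reduceMod V q₃ hq₃) ?_ ?_ ?_
  · obtain ⟨h', e⟩ := reduceMod_some_rat V q₁ hq₁ (nonsingular_rat_of_eq_rat V hΔ h₁) hd₁.1 hd₁.2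
      hm₁.1 hm₁.2
    rw [e]
    exact not_mem_twoCoset_one_of_xCosetFree V q₁ hw₁ _
  · obtain ⟨h', e⟩ := reduceMod_some_rat V q₂ hq₂ (nonsingular_rat_of_eq_rat V hΔ h₂) hd₂.1 hd₂.2
      hm₂.1 hm₂.2
    rw [e]
    exact not_mem_twoCoset_one_of_xCosetFree V q₂ hw₂ _
  · rw [some_add_some_of_ratChord V hΔ h₁ h₂ h₃ hc]
    obtain ⟨h', e⟩ := reduceMod_some_rat V q₃ hq₃ (nonsingular_rat_of_eq_rat V hΔ h₃) hd₃.1 hd₃.2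
      hm₃.1 hm₃.2
    rw [e]
    exact not_mem_twoCoset_one_of_xCosetFree V q₃ hw₃ _

end Assembly

end Summit.BirchSwinnertonDyer.BirchSwinnertonDyer.Rank2Observatory
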